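import Literature.NumberTheory.LFunctions.WeilMellinInversion
import Mathlib.Analysis.Fourier.PoissonSummation

/-!
# Poisson summation for `ĝ` along an arithmetic progression

Negative-side support for crux `SpectralTrace.WindowTracePrime2` (stmt-RiemannHypothesis-11196;
cdisprove seat refuter-cdisprove-stmt-RiemannHypothesis-11196-0), engine of the lattice no-go
`Negative/Progressions.lean`.

* `fourier_lineSample` — the Fourier transform (Mathlib normalisation) of
  `x ↦ ĝ(1/2 + i(αx + β))` is `w ↦ (2π/α) e^{2πiβw/α} g(2πw/α)` (`α > 0`): substitution plus the
  tree's Mellin = Fourier inversion `weilMellin_inversion`.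
* `tsum_lineSample` — **Poisson summation**: for a Weil test `g`, `α > 0`, real `β`,
  `Σ_{n ∈ ℤ} ĝ(1/2 + i(αn + β)) = (2π/α) Σ_{k ∈ ℤ} e^{2πikβ/α} g(2πk/α)`, a FINITE combination of
  point values of `g` on the dual lattice (the `k`-aliasing formula of a lattice of quasi-zeros).
* `tsum_lineSample_eq_zero'` — hence the progression sum VANISHES for every `α ≠ 0` as soon as `g`
  vanishes on `(2π/α)ℤ`.
-/

noncomputable section

open Complex Filter Set MeasureTheory
open scoped Real Topology FourierTransform

namespace Summit.RiemannHypothesis.RiemannHypothesis.Theorems.WindowTracePrime2.Negative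

open Literature.NumberTheory.LFunctions

/-- The sample `ĝ(1/2 + i(αx+β))` with the real part written as a cast real `1/2` (the form of the
vertical-line API of `WeilMellinInversion`). [folklore] -/
theorem lineSample_eq (g : ℝ → ℂ) (α β x : ℝ) :
    weilMellin g (1 / 2 + ((α * x + β : ℝ) : ℂ) * I) =
      weilMellin g (((1 / 2 : ℝ) : ℂ) + ((α * x + β : ℝ) : ℂ) * I) := by
  push_cast
  ring_nf

/-- The samples depend continuously on `x`. [folklore] -/
theorem continuous_lineSample {g : ℝ → ℂ} (hg : IsWeilTest g) (α β : ℝ) :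
    Continuous (fun x : ℝ => weilMellin g (1 / 2 + ((α * x + β : ℝ) : ℂ) * I)) := by
  have h := continuous_weilMellin_vertical hg.1.continuous hg.2 (1 / 2)
  have : (fun x : ℝ => weilMellin g (1 / 2 + ((α * x + β : ℝ) : ℂ) * I)) =
      (fun y : ℝ => weilMellin g (((1 / 2 : ℝ) : ℂ) + y * I)) ∘ fun x => α * x + β := by
    ext x
    simp only [Function.comp_apply, lineSample_eq]
  rw [this]
  exact h.comp (by fun_prop)

/-- `‖ĝ(1/2 + i(αx+β))‖ ≤ C_g/(1 + (αx+β)²)`. [folklore] -/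
theorem norm_lineSample_le {g : ℝ → ℂ} (hg : IsWeilTest g) (α β x : ℝ) :
    ‖weilMellin g (1 / 2 + ((α * x + β : ℝ) : ℂ) * I)‖ ≤ weilDecayW 0 g * (1 + (α * x + β) ^ 2)⁻¹ := by
  have h := norm_weilMellin_vertical_le hg (1 / 2) (α * x + β)
  rw [show |(1 / 2 : ℝ) - 1 / 2| = 0 by norm_num] at h
  rwa [lineSample_eq]

/-- Decay `O(|x|⁻²)` of the samples (from `‖ĝ(1/2+iy)‖ ≤ C/(1+y²)`). -/
theorem isBigO_lineSample {g : ℝ → ℂ} (hg : IsWeilTest g) {α : ℝ} (hα : α ≠ 0) (β : ℝ) :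
    (fun x : ℝ => weilMellin g (1 / 2 + ((α * x + β : ℝ) : ℂ) * I)) =O[cocompact ℝ]
      fun x : ℝ => |x| ^ (-2 : ℝ) := by
  set C := weilDecayW 0 g with hC
  have hC0 : 0 ≤ C := weilDecayW_nonneg 0 g
  have hαpos : 0 < |α| := abs_pos.2 hα
  refine Asymptotics.IsBigO.of_bound (C * (4 / α ^ 2)) ?_
  have hR : (Set.Icc (-(2 * |β| / |α|)) (2 * |β| / |α|))ᶜ ∈ cocompact ℝ :=
    isCompact_Icc.compl_mem_cocompact
  filter_upwards [hR] with x hx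
  have hx' : 2 * |β| / |α| < |x| := by
    simp only [Set.mem_compl_iff, Set.mem_Icc, not_and_or, not_le] at hx
    have hnn : 0 ≤ 2 * |β| / |α| := by positivity
    rcases hx with h | h
    · have hneg : x < 0 := by linarith
      rw [abs_of_neg hneg]
      linarith
    · exact lt_of_lt_of_le h (le_abs_self x)
  have hxpos : 0 < |x| := lt_of_le_of_lt (by positivity) hx'
  have hβ : 2 * |β| < |α| * |x| := by
    have := (div_lt_iff₀ hαpos).1 hx'
    linarith
  have hlow : |α| * |x| / 2 ≤ |α * x + β| := by
    have h1 : |α * x| ≤ |α * x + β| + |β| := by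
      have := abs_add_le (α * x + β) (-β)
      simpa using this
    rw [abs_mul] at h1
    linarith
  have hlowpos : 0 < |α| * |x| / 2 := by positivity
  have hsq : (|α| * |x| / 2) ^ 2 ≤ (α * x + β) ^ 2 := by
    rw [← sq_abs (α * x + β)]
    exact pow_le_pow_left₀ hlowpos.le hlow 2
  have hinv : (1 + (α * x + β) ^ 2)⁻¹ ≤ 4 / α ^ 2 * (x ^ 2)⁻¹ := by
    have h2 : (|α| * |x| / 2) ^ 2 ≤ 1 + (α * x + β) ^ 2 := by linarith
    calc (1 + (α * x + β) ^ 2)⁻¹ ≤ ((|α| * |x| / 2) ^ 2)⁻¹ := by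
          exact inv_anti₀ (by positivity) h2
      _ = 4 / α ^ 2 * (x ^ 2)⁻¹ := by
          rw [show (|α| * |x| / 2) ^ 2 = α ^ 2 * x ^ 2 / 4 by
            rw [div_pow, mul_pow, sq_abs, sq_abs]; norm_num]
          have hx0 : x ≠ 0 := abs_pos.1 hxpos
          field_simp
  have hnorm : ‖(|x| ^ (-2 : ℝ))‖ = (x ^ 2)⁻¹ := by
    rw [Real.norm_of_nonneg (Real.rpow_nonneg (abs_nonneg x) _), Real.rpow_neg (abs_nonneg x),
      show (2 : ℝ) = ((2 : ℕ) : ℝ) by norm_num, Real.rpow_natCast, sq_abs]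
  rw [hnorm]
  calc ‖weilMellin g (1 / 2 + ((α * x + β : ℝ) : ℂ) * I)‖
        ≤ C * (1 + (α * x + β) ^ 2)⁻¹ := norm_lineSample_le hg α β x
    _ ≤ C * (4 / α ^ 2 * (x ^ 2)⁻¹) := mul_le_mul_of_nonneg_left hinv hC0
    _ = C * (4 / α ^ 2) * (x ^ 2)⁻¹ := by ring

/-- **The Fourier transform of the samples** (Mathlib normalisation `𝓕 f(w) = ∫ e^{-2πivw} f(v) dv`):
`𝓕(lineSample g α β)(w) = (2π/α) e^{2πiwβ/α} g(2πw/α)` for `α > 0` — substitution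
`y = αv + β` and Mellin (= Fourier) inversion `∫ ĝ(1/2+iy) e^{-iyt} dy = 2π g(t)`
(`weilMellin_inversion`). -/
theorem fourier_lineSample {g : ℝ → ℂ} (hg : IsWeilTest g) {α : ℝ} (hα : 0 < α) (β w : ℝ) :
    𝓕 (fun x : ℝ => weilMellin g (1 / 2 + ((α * x + β : ℝ) : ℂ) * I)) w =
      ((2 * π / α : ℝ) : ℂ) * cexp (2 * π * β * w / α * I) * g (2 * π * w / α) := by
  rw [Real.fourier_real_eq_integral_exp_smul]
  simp only [smul_eq_mul]
  set F : ℝ → ℂ := fun y =>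
    cexp ((((-2) * π * ((y - β) / α) * w : ℝ) : ℂ) * I) *
      weilMellin g (((1 / 2 : ℝ) : ℂ) + (y : ℂ) * I) with hF
  have hint : (fun v : ℝ => cexp (((-2 * π * v * w : ℝ) : ℂ) * I) * weilMellin g (1 / 2 + ((α * v + β : ℝ) : ℂ) * I)) =
      fun v => F (α * v + β) := by
    have hα' : (α : ℂ) ≠ 0 := by exact_mod_cast hα.ne'
    ext v
    simp only [hF, lineSample_eq]
    congr 3
    push_cast
    field_simp
    ring
  rw [hint]
  have h1 : ∫ v : ℝ, F (α * v + β) = |α⁻¹| • ∫ y : ℝ, F (y + β) :=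
    Measure.integral_comp_mul_left (fun u => F (u + β)) α
  have h2 : ∫ y : ℝ, F (y + β) = ∫ y : ℝ, F y := integral_add_right_eq_self (fun y => F y) β
  rw [h1, h2, abs_of_pos (inv_pos.2 hα)]
  have h3 : ∀ y : ℝ, F y = cexp (2 * π * β * w / α * I) *
      (weilMellin g (((1 / 2 : ℝ) : ℂ) + (y : ℂ) * I) * cexp (-((y : ℂ) * I) * ((2 * π * w / α : ℝ) : ℂ))) := by
    intro y
    have hα' : (α : ℂ) ≠ 0 := by exact_mod_cast hα.ne'
    have he : cexp ((((-2) * π * ((y - β) / α) * w : ℝ) : ℂ) * I) =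
        cexp (2 * π * β * w / α * I) * cexp (-((y : ℂ) * I) * ((2 * π * w / α : ℝ) : ℂ)) := by
      rw [← Complex.exp_add]
      congr 1
      push_cast
      field_simp
      ring
    simp only [hF]
    rw [he]
    ring
  simp_rw [h3]
  rw [integral_const_mul, weilMellin_inversion hg (1 / 2) (2 * π * w / α)]
  rw [Complex.real_smul]
  push_cast
  ring_nf
  simp

/-- A compactly supported `g` vanishes at the lattice points `2πk/α` for all but finitely many
`k : ℤ`. -/
theorem exists_finset_lattice_zero {g : ℝ → ℂ} (hg : HasCompactSupport g) {α : ℝ} (hα : 0 < α) :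
    ∃ N : ℕ, ∀ k : ℤ, k ∉ Finset.Icc (-(N : ℤ)) N → g (2 * π * k / α) = 0 := by
  obtain ⟨R, hR⟩ := hg.isCompact.isBounded.subset_closedBall 0
  refine ⟨⌈|R| * α / (2 * π)⌉₊, fun k hk => ?_⟩
  apply image_eq_zero_of_notMem_tsupport
  intro hmem
  have h1 := hR hmem
  rw [Metric.mem_closedBall, dist_zero_right, Real.norm_eq_abs] at h1
  have hkR : |R| * α / (2 * π) < |(k : ℝ)| := by
    simp only [Finset.mem_Icc, not_and_or, not_le] at hk
    have hceil : |R| * α / (2 * π) ≤ (⌈|R| * α / (2 * π)⌉₊ : ℝ) := Nat.le_ceil _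
    rcases hk with hk | hk
    · have h' : (k : ℝ) < -(⌈|R| * α / (2 * π)⌉₊ : ℝ) := by exact_mod_cast hk
      have hN0 : (0 : ℝ) ≤ (⌈|R| * α / (2 * π)⌉₊ : ℝ) := Nat.cast_nonneg _
      have hkneg : (k : ℝ) < 0 := by linarith
      rw [abs_of_neg hkneg]
      linarith
    · have : (⌈|R| * α / (2 * π)⌉₊ : ℝ) < (k : ℝ) := by exact_mod_cast hk
      exact lt_of_lt_of_le (hceil.trans_lt this) (le_abs_self _)
  have h2 : |2 * π * (k : ℝ) / α| = 2 * π * |(k : ℝ)| / α := by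
    rw [abs_div, abs_mul, abs_of_pos (by positivity : (0 : ℝ) < 2 * π), abs_of_pos hα]
  rw [h2] at h1
  have h3 : 2 * π * |(k : ℝ)| / α > |R| := by
    rw [gt_iff_lt, lt_div_iff₀ hα]
    have := (div_lt_iff₀ (by positivity : (0 : ℝ) < 2 * π)).1 hkR
    linarith
  linarith [le_abs_self R]

/-- The Fourier transform of the samples is summable over `ℤ` (finitely many non-zero terms). -/
theorem summable_fourier_lineSample {g : ℝ → ℂ} (hg : IsWeilTest g) {α : ℝ} (hα : 0 < α) (β : ℝ) :
    Summable fun k : ℤ => 𝓕 (fun x : ℝ => weilMellin g (1 / 2 + ((α * x + β : ℝ) : ℂ) * I)) k := by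
  obtain ⟨N, hN⟩ := exists_finset_lattice_zero hg.2 hα
  refine summable_of_ne_finset_zero (s := Finset.Icc (-(N : ℤ)) N) fun k hk => ?_
  rw [fourier_lineSample hg hα, hN k hk, mul_zero]

/-- **Poisson summation along a progression**: for a Weil test `g`, `α > 0` and real `β`,
`Σ_{n ∈ ℤ} ĝ(1/2 + i(αn + β)) = (2π/α) Σ_{k ∈ ℤ} e^{2πikβ/α} g(2πk/α)` — a FINITE combination of
point values of `g` at the dual lattice `(2π/α)ℤ`. (This is the `k`-aliasing formula of the
route's chirped-lattice ansatz, in the un-chirped case.) -/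
theorem tsum_lineSample {g : ℝ → ℂ} (hg : IsWeilTest g) {α : ℝ} (hα : 0 < α) (β : ℝ) :
    ∑' n : ℤ, weilMellin g (1 / 2 + ((α * n + β : ℝ) : ℂ) * I) =
      ∑' k : ℤ, ((2 * π / α : ℝ) : ℂ) * cexp (2 * π * β * k / α * I) * g (2 * π * k / α) := by
  have hP := Real.tsum_eq_tsum_fourier_of_rpow_decay_of_summable (continuous_lineSample hg α β)
    one_lt_two (isBigO_lineSample hg hα.ne' β) (summable_fourier_lineSample hg hα β) 0
  simp only [zero_add] at hP
  rw [hP]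
  refine tsum_congr fun k => ?_
  rw [fourier_lineSample hg hα, fourier_coe_apply]
  simp

/-- Hence if `g` vanishes on the dual lattice `(2π/α)ℤ` the whole progression sum VANISHES. -/
theorem tsum_lineSample_eq_zero {g : ℝ → ℂ} (hg : IsWeilTest g) {α : ℝ} (hα : 0 < α) (β : ℝ)
    (h0 : ∀ k : ℤ, g (2 * π * k / α) = 0) :
    ∑' n : ℤ, weilMellin g (1 / 2 + ((α * n + β : ℝ) : ℂ) * I) = 0 := by
  rw [tsum_lineSample hg hα β]
  simp [h0]

/-- The same for `α < 0` (re-index `n ↦ -n`), hence for every `α ≠ 0`. -/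
theorem tsum_lineSample_eq_zero' {g : ℝ → ℂ} (hg : IsWeilTest g) {α : ℝ} (hα : α ≠ 0) (β : ℝ)
    (h0 : ∀ k : ℤ, g (2 * π * k / α) = 0) :
    ∑' n : ℤ, weilMellin g (1 / 2 + ((α * n + β : ℝ) : ℂ) * I) = 0 := by
  rcases hα.lt_or_gt with hneg | hpos
  · have h1 : (fun n : ℤ => weilMellin g (1 / 2 + ((α * n + β : ℝ) : ℂ) * I)) =
        fun n : ℤ => weilMellin g (1 / 2 + ((-α * ((Equiv.neg ℤ) n : ℤ) + β : ℝ) : ℂ) * I) := by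
      ext n
      simp only [Equiv.neg_apply, Int.cast_neg, mul_neg, neg_mul, neg_neg]
    rw [h1, Equiv.tsum_eq (Equiv.neg ℤ)
      (fun n : ℤ => weilMellin g (1 / 2 + ((-α * n + β : ℝ) : ℂ) * I))]
    refine tsum_lineSample_eq_zero hg (neg_pos.2 hneg) β fun k => ?_
    have := h0 (-k)
    rw [← this]
    congr 1
    push_cast
    field_simp
  · exact tsum_lineSample_eq_zero hg hpos β h0

end Summit.RiemannHypothesis.RiemannHypothesis.Theorems.WindowTracePrime2.Negative

end
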